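import Literature.AlgebraicGeometry.HodgeTheory.TorsionClassesDegreeTwoDieGenerically
import Literature.AlgebraicGeometry.Motives.UnramifiedCohomology

/-!
# The generically-zero integral classes form a cup ideal containing the integral `(1,1)`-classes

For a `ℂ`-scheme `X` and a coefficient ring `A`, the coniveau filtration
`Nʳ H^*(X(ℂ); A) = coniveauFiltration A X * r` (classes dying on the complex points of the complement
of a Zariski-closed subset of codimension `≥ r`, Bloch–Ogus 1974 (3.8)) is a two-sided ideal for the
cup product: `f^*(a ⌣ b) = f^*a ⌣ f^*b` for the restriction `f^*` to `(X ∖ Z)(ℂ)` (Hatcher,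
Prop. 3.10).  For `X` smooth projective over `ℂ` and `A = ℤ`, `r = 1`, the tree's INTEGRAL Lefschetz
theorem on `(1,1)`-classes in Zariski-local form (`integralLefschetzOneOne`: Voisin I, Thm. 11.30 with
Rem. 7.9 and Thm. 11.33 — every `z ∈ H²(X(ℂ); ℤ)` with `(1,1)` complexification, torsion included,
dies on a non-empty Zariski open) says that `N¹ H²(X(ℂ); ℤ)` contains every integral `(1,1)`-class.
Hence every class in the ideal of `H^*(X(ℂ); ℤ)` generated by the integral `(1,1)`-classes — sums of
cup products `D ⌣ w` and `w ⌣ D` with `D` an integral `(1,1)`-class and `w` arbitrary — restricts to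
`0` on the complex points of ONE non-empty Zariski open (finite unions of proper closed subsets of the
irreducible `X` are proper):

* `cupProduct_mem_coniveauFiltration_of_left`, `cupProduct_mem_coniveauFiltration_of_right` — the
  ideal property of `Nʳ`, any coefficients;
* `exists_ne_univ_restrictToCompl_eq_zero_iff_mem_coniveauFiltration_one` — on an irreducible `X`,
  `z ∈ N¹` iff `z` dies off ONE proper Zariski-closed subset;
* `mem_coniveauFiltration_one_of_isOfHodgeType_oneOne`, `mem_coniveauFiltration_one_of_nsmul_eq_zero`
  — integral `(1,1)`-classes, in particular torsion classes of degree `2`, lie in `N¹ H²(X(ℂ); ℤ)`;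
* `cupProduct_mem_coniveauFiltration_one_of_isOfHodgeType_oneOne_left/right`,
  `span_cupProduct_oneOne_le_coniveauFiltration_one` — the ideal generated by the integral
  `(1,1)`-classes lies in `N¹ H^*(X(ℂ); ℤ)`;
* `exists_restrictToCompl_eq_zero_of_mem_span_cupProduct_oneOne` — unfolded: such a class dies on the
  complex points of a non-empty Zariski open, in integral cohomology.

References: C. Voisin, *Hodge Theory and Complex Algebraic Geometry I* (2002), Thm. 11.30, Rem. 7.9,
Thm. 11.33 [VoisinHodgeI2002]; S. Bloch, A. Ogus, *Gersten's conjecture and the homology of schemes*,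
Ann. Sci. ÉNS 7 (1974), (3.8) [BlochOgus1974ENS]; A. Hatcher, *Algebraic Topology* (2002), Prop. 3.10
[HatcherAT2002].
-/

noncomputable section

open Literature.AlgebraicTopology.SingularHomology Literature.AlgebraicGeometry.Motives
open AlgebraicGeometry

namespace Literature.AlgebraicGeometry.HodgeTheory

/-! ### `Nʳ H^*(X(ℂ); A)` is a two-sided cup ideal -/

section Ideal

variable (A : Type) [CommRing A] {X : SchemeOver ℂ}

/-- **`Nʳ ⌣ H ⊆ Nʳ`.** If `a ∈ Nʳ Hᵖ(X(ℂ); A)` then `a ⌣ b ∈ Nʳ Hᵏ(X(ℂ); A)` for every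
`b ∈ H^q(X(ℂ); A)`, `p + q = k`: if `a` dies on `(X ∖ Z)(ℂ)` so does `a ⌣ b`, by naturality of the cup
product under restriction. [cite: HatcherAT2002, Prop. 3.10] [cite: BlochOgus1974ENS, (3.8)] -/
theorem cupProduct_mem_coniveauFiltration_of_left {p q k r : ℕ} (h : p + q = k)
    {a : singularCohomology A A (ComplexPoints X) p} (ha : a ∈ coniveauFiltration A X p r)
    (b : singularCohomology A A (ComplexPoints X) q) :
    cupProduct h a b ∈ coniveauFiltration A X k r := by
  obtain ⟨Z, hZ, hr, h0⟩ := (mem_coniveauFiltration_iff_exists A p).1 ha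
  refine mem_coniveauFiltration_of_restrictToCompl_eq_zero A k hZ hr ?_
  change singularCohomology.map A A _ k (cupProduct h a b) = 0
  rw [cupProduct_map]
  change cupProduct h (restrictToCompl A X p Z a) _ = 0
  rw [h0, map_zero, LinearMap.zero_apply]

/-- **`H ⌣ Nʳ ⊆ Nʳ`.** If `b ∈ Nʳ H^q(X(ℂ); A)` then `a ⌣ b ∈ Nʳ Hᵏ(X(ℂ); A)` for every
`a ∈ Hᵖ(X(ℂ); A)`, `p + q = k` (no graded commutativity is used: naturality in the second variable).
[cite: HatcherAT2002, Prop. 3.10] [cite: BlochOgus1974ENS, (3.8)] -/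
theorem cupProduct_mem_coniveauFiltration_of_right {p q k r : ℕ} (h : p + q = k)
    (a : singularCohomology A A (ComplexPoints X) p)
    {b : singularCohomology A A (ComplexPoints X) q} (hb : b ∈ coniveauFiltration A X q r) :
    cupProduct h a b ∈ coniveauFiltration A X k r := by
  obtain ⟨Z, hZ, hr, h0⟩ := (mem_coniveauFiltration_iff_exists A q).1 hb
  refine mem_coniveauFiltration_of_restrictToCompl_eq_zero A k hZ hr ?_
  change singularCohomology.map A A _ k (cupProduct h a b) = 0
  rw [cupProduct_map]
  change cupProduct h _ (restrictToCompl A X q Z b) = 0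
  rw [h0, map_zero]

/-- **`N¹` on an irreducible scheme, unfolded.** A class lies in `N¹ H^q(X(ℂ); A)` iff it dies on the
complex points of the complement of ONE Zariski-closed `Z ≠ X` (on an irreducible `X`, "every point of
the closed `Z` has codimension `≥ 1`" iff `Z ≠ X`). [cite: BlochOgus1974ENS, (3.8)] -/
theorem exists_ne_univ_restrictToCompl_eq_zero_iff_mem_coniveauFiltration_one
    [IrreducibleSpace X.left] {q : ℕ} (z : singularCohomology A A (ComplexPoints X) q) :
    (∃ Z : Set X.left, IsClosed Z ∧ Z ≠ Set.univ ∧ restrictToCompl A X q Z z = 0) ↔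
      z ∈ coniveauFiltration A X q 1 := by
  rw [mem_coniveauFiltration_iff_exists]
  refine ⟨fun ⟨Z, hZ, hZne, h0⟩ ↦ ⟨Z, hZ, ?_, h0⟩, fun ⟨Z, hZ, hr, h0⟩ ↦ ⟨Z, hZ, ?_, h0⟩⟩
  · exact_mod_cast (forall_one_le_coheight_iff_ne_univ hZ).2 hZne
  · exact (forall_one_le_coheight_iff_ne_univ hZ).1 (by exact_mod_cast hr)

end Ideal

/-! ### Integral `(1,1)`-classes lie in `N¹ H²(X(ℂ); ℤ)` -/

section OneOne

variable {n : ℕ} {X : SchemeOver ℂ}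

/-- **Integral Lefschetz `(1,1)`, coniveau form.** For `X` smooth projective over `ℂ`, every
`z ∈ H²(X(ℂ); ℤ)` whose complexification is of Hodge type `(1,1)` lies in `N¹ H²(X(ℂ); ℤ)`
(`integralLefschetzOneOne`). [cite: VoisinHodgeI2002, Thm. 11.30, Rem. 7.9, Thm. 11.33]
[cite: BlochOgus1974ENS, (3.8)] -/
theorem mem_coniveauFiltration_one_of_isOfHodgeType_oneOne (hX : IsSmoothProjective n X)
    (z : singularCohomology ℤ ℤ (ComplexPoints X) 2)
    (hz : IsOfHodgeType n X 2 1 1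
      (singularCohomology.ringChange (Int.castRingHom ℂ) (ComplexPoints X) 2 z)) :
    z ∈ coniveauFiltration ℤ X 2 1 := by
  haveI := IsSmoothProjective.isIntegral_holds hX
  obtain ⟨Z, hZ, hZne, h0⟩ := integralLefschetzOneOne hX z hz
  exact (exists_ne_univ_restrictToCompl_eq_zero_iff_mem_coniveauFiltration_one ℤ z).1
    ⟨Z, hZ, hZne, h0⟩

/-- Torsion classes of degree `2` lie in `N¹ H²(X(ℂ); ℤ)` (`torsionClass_two_map_eq_zero`: their
complexification `0` is of type `(1,1)`). [cite: VoisinHodgeI2002, Thm. 11.30, Rem. 7.9, Thm. 11.33]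
[cite: ColliotTheleneVoisin2012, Thm 3.1] -/
theorem mem_coniveauFiltration_one_of_nsmul_eq_zero (hX : IsSmoothProjective n X)
    (z : singularCohomology ℤ ℤ (ComplexPoints X) 2) {N : ℕ} (hN : 1 ≤ N) (hz : N • z = 0) :
    z ∈ coniveauFiltration ℤ X 2 1 := by
  haveI := IsSmoothProjective.isIntegral_holds hX
  obtain ⟨Z, hZ, hZne, h0⟩ := torsionClass_two_map_eq_zero hX z hN hz
  exact (exists_ne_univ_restrictToCompl_eq_zero_iff_mem_coniveauFiltration_one ℤ z).1
    ⟨Z, hZ, hZne, h0⟩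

/-- **`D ⌣ w ∈ N¹` for `D` an integral `(1,1)`-class**, `w ∈ H^q(X(ℂ); ℤ)` arbitrary, `2 + q = k`.
[cite: VoisinHodgeI2002, Thm. 11.30, Rem. 7.9, Thm. 11.33] [cite: HatcherAT2002, Prop. 3.10] -/
theorem cupProduct_mem_coniveauFiltration_one_of_isOfHodgeType_oneOne_left
    (hX : IsSmoothProjective n X) {q k : ℕ} (h : 2 + q = k)
    (D : singularCohomology ℤ ℤ (ComplexPoints X) 2)
    (hD : IsOfHodgeType n X 2 1 1
      (singularCohomology.ringChange (Int.castRingHom ℂ) (ComplexPoints X) 2 D))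
    (w : singularCohomology ℤ ℤ (ComplexPoints X) q) :
    cupProduct h D w ∈ coniveauFiltration ℤ X k 1 :=
  cupProduct_mem_coniveauFiltration_of_left ℤ h
    (mem_coniveauFiltration_one_of_isOfHodgeType_oneOne hX D hD) w

/-- **`w ⌣ D ∈ N¹` for `D` an integral `(1,1)`-class**, `w ∈ H^q(X(ℂ); ℤ)` arbitrary, `q + 2 = k`.
[cite: VoisinHodgeI2002, Thm. 11.30, Rem. 7.9, Thm. 11.33] [cite: HatcherAT2002, Prop. 3.10] -/
theorem cupProduct_mem_coniveauFiltration_one_of_isOfHodgeType_oneOne_right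
    (hX : IsSmoothProjective n X) {q k : ℕ} (h : q + 2 = k)
    (w : singularCohomology ℤ ℤ (ComplexPoints X) q)
    (D : singularCohomology ℤ ℤ (ComplexPoints X) 2)
    (hD : IsOfHodgeType n X 2 1 1
      (singularCohomology.ringChange (Int.castRingHom ℂ) (ComplexPoints X) 2 D)) :
    cupProduct h w D ∈ coniveauFiltration ℤ X k 1 :=
  cupProduct_mem_coniveauFiltration_of_right ℤ h w
    (mem_coniveauFiltration_one_of_isOfHodgeType_oneOne hX D hD)

/-- **The ideal generated by the integral `(1,1)`-classes lies in `N¹ H^*(X(ℂ); ℤ)`**: the `ℤ`-span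
of the degree-`k` generators of the two-sided ideal of `H^*(X(ℂ); ℤ)` generated by the integral
`(1,1)`-classes — the cup products `D ⌣ w` (`2 + q = k`) and `w ⌣ D` (`q + 2 = k`) with
`D ∈ H²(X(ℂ); ℤ)` of `(1,1)` complexification and `w ∈ H^q(X(ℂ); ℤ)` arbitrary — is contained in the
coniveau-`1` integral classes (`N¹` is a submodule and a two-sided cup ideal containing the
`(1,1)`-classes). [cite: VoisinHodgeI2002, Thm. 11.30, Rem. 7.9, Thm. 11.33] [cite: BlochOgus1974ENS, (3.8)] -/
theorem span_cupProduct_oneOne_le_coniveauFiltration_one (hX : IsSmoothProjective n X) (k : ℕ) :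
    Submodule.span ℤ {z : singularCohomology ℤ ℤ (ComplexPoints X) k |
        ∃ (q : ℕ) (D : singularCohomology ℤ ℤ (ComplexPoints X) 2)
          (w : singularCohomology ℤ ℤ (ComplexPoints X) q),
          IsOfHodgeType n X 2 1 1
            (singularCohomology.ringChange (Int.castRingHom ℂ) (ComplexPoints X) 2 D) ∧
          ((∃ h : 2 + q = k, z = cupProduct h D w) ∨ (∃ h : q + 2 = k, z = cupProduct h w D))} ≤
      coniveauFiltration ℤ X k 1 := by
  refine Submodule.span_le.2 ?_
  rintro z ⟨q, D, w, hD, (⟨h, rfl⟩ | ⟨h, rfl⟩)⟩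
  · exact cupProduct_mem_coniveauFiltration_one_of_isOfHodgeType_oneOne_left hX h D hD w
  · exact cupProduct_mem_coniveauFiltration_one_of_isOfHodgeType_oneOne_right hX h w D hD

/-- **Unfolded: classes in the ideal of the integral `(1,1)`-classes die on a non-empty Zariski
open, integrally.** For `X` smooth projective over `ℂ` and `z ∈ Hᵏ(X(ℂ); ℤ)` in the `ℤ`-span of the
cup products `D ⌣ w`, `w ⌣ D` (`D` of `(1,1)` complexification), there is a Zariski-closed `Z ≠ X`
with `z|_{(X ∖ Z)(ℂ)} = 0` in `Hᵏ((X ∖ Z)(ℂ); ℤ)`.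
[cite: VoisinHodgeI2002, Thm. 11.30, Rem. 7.9, Thm. 11.33] [cite: BlochOgus1974ENS, (3.8)] -/
theorem exists_restrictToCompl_eq_zero_of_mem_span_cupProduct_oneOne
    (hX : IsSmoothProjective n X) {k : ℕ} {z : singularCohomology ℤ ℤ (ComplexPoints X) k}
    (hz : z ∈ Submodule.span ℤ {z : singularCohomology ℤ ℤ (ComplexPoints X) k |
        ∃ (q : ℕ) (D : singularCohomology ℤ ℤ (ComplexPoints X) 2)
          (w : singularCohomology ℤ ℤ (ComplexPoints X) q),
          IsOfHodgeType n X 2 1 1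
            (singularCohomology.ringChange (Int.castRingHom ℂ) (ComplexPoints X) 2 D) ∧
          ((∃ h : 2 + q = k, z = cupProduct h D w) ∨ (∃ h : q + 2 = k, z = cupProduct h w D))}) :
    ∃ Z : Set X.left, IsClosed Z ∧ Z ≠ Set.univ ∧
      singularCohomology.map ℤ ℤ
        (⟨Subtype.val, continuous_subtype_val⟩ : C(complexPointsCompl X Z, ComplexPoints X)) k z = 0 := by
  haveI := IsSmoothProjective.isIntegral_holds hX
  exact (exists_ne_univ_restrictToCompl_eq_zero_iff_mem_coniveauFiltration_one ℤ z).2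
    (span_cupProduct_oneOne_le_coniveauFiltration_one hX k hz)

end OneOne

end Literature.AlgebraicGeometry.HodgeTheory
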